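import Mathlib.Algebra.Homology.DerivedCategory.Ext.Map
import Mathlib.Algebra.BigOperators.Pi
import Mathlib.Algebra.Group.Pi.Lemmas
import HarnessLib

/-!
# Venture HSemireg — route R1.0, untwisted reading: **the triangular Leibniz re-expansion of the traced Yoneda
# powers, from the Leibniz rule, centrality and trace linearity, on `Ext` carriers** (gs-g4; the abstract assembly of
# ALL rows `q` of `hσ`, `general-structure/LEIBNIZ-ROW2-PLAN-gs-g4.md` §5 (L7))

HONEST FRAMING. Pure homological algebra in abelian categories `C`, `D` with `Ext` (Mathlib `Abelian.Ext`) and an exact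
functor `T : C ⥤ D` (`Ext.mapExactFunctor`); every geometric input is a HYPOTHESIS. This is the `Ext`-carrier form of
th-4's ring-level `UntwistSigmaMultiplier.sigma_leibniz_triangular`: there the Buchweitz–Flenner algebra was an abstract
ring; here the objects are sequences `F_j`, `G_j` (`E ⊗ Ωʲ`, `E⟨c⟩ ⊗ Ωʲ`), the classes are honest `Ext¹`-classes composed
by Yoneda composition, and the conclusion is ready to be instantiated on the tree's real carriers (sequel file).
Nothing about any variety; nothing here says HC, HC_CM or HC_AV is proved.

SETTING (all data hypotheses). `E : C`; `F_j : C`, `G_j : D`; `λ_j : T(F_j) ⟶ G_j`; `α_j ∈ Ext¹(F_j, F_{j+1})`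
("`at_j(E)`"), `β_j ∈ Ext¹(G_j, G_{j+1})` ("`at_j(E⟨c⟩)`"), `γ_j ∈ Ext¹(G_j, G_{j+1})` ("`ν′_j = ω ∧ –`"); additive
"traces" `Tr_i : Ext^{i+2}(E, F_i) → W_i`, `Tr′_i : Ext^{i+2}(T E, G_i) → W_i`, "cups" `K_i : W_i → W_{i+1}`, and, below
a bound `N` on the form degree:
* LEIBNIZ `[λ_j] · β_j = T(α_j) · [λ_{j+1}] + [λ_j] · γ_j` (`UntwistCocycleTwistAtiyahHigher.atiyahClassStep_twist`);
* CENTRALITY `γ_m · β_{m+1} = β_m · γ_{m+1}` (th-4, `UntwistAtiyahStepCommuteLocFree`);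
* COMPARISON `Tr′_i(T(y) · [λ_i]) = Tr_i(y)` (`UntwistCocycleTwistDualHomTrace`);
* LINEARITY `Tr′_{i+1}(w · γ_i) = K_i(Tr′_i(w))` (`UntwistCocycleTwistWedgeTrace`).

WHAT IS PROVED.
* `IsExtChain G β j q n c` — the inductive predicate "`c ∈ Extⁿ(G_j, G_q)` is the Yoneda chain `β_j · β_{j+1} ⋯ β_{q-1}`"
  (so `n = q - j`). Recursively DEFINED powers (`B_0 = [𝟙]`, `B_{q+1} = B_q · β_q`, like `atiyahClassPower`) have a
  fixed start; the induction below PREPENDS classes and needs chains with a variable start, where the dependent types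
  `Ext(G_j, G_{j+k})` would meet the non-definitional `(j + 1) + k = j + (k + 1)`; making start, end and length free
  indices of a predicate avoids all transport. Lemmas: `IsExtChain.add_eq` (`j + n = q`), `IsExtChain.unique`,
  `exists_isExtChain` / `exists_isExtChain_of_le`, `isExtChain_of_pow` (recursive powers are the chains from `0`),
  `IsExtChain.exists_cons` (**prepending** `β_j ⋯ β_{q-1} = β_j · (β_{j+1} ⋯ β_{q-1})`), `IsExtChain.comp_central`
  (**pushing a commuting family through**: `γ_m · β_{m+1} = β_m · γ_{m+1}` ⇒ `(β_j ⋯ β_{q-1}) · γ_q = γ_j · (β_{j+1} ⋯ β_q)`).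
* **`exists_triangular_chain`** — for `j + k = q ≤ N` there are additive `V_i : W_i → W_q` such that for every family
  `S_i ∈ Ext^{i+2}(E, F_i)` with `S_{i+1} = S_i · α_i` (think `S_i = x · ι · At(E)^i`) and every Yoneda chain
  `c = β_j ⋯ β_{q-1}`: `Tr′_q((T(S_j) · [λ_j]) · c) = Tr_q(S_q) + Σ_{i<q} V_i(Tr_i(S_i))` — induction on `k`: prepend
  `β_j`, Leibniz, push `γ_j` through the rest of the chain by centrality, trace linearity;
* **`exists_triangular`** — `j = 0` against recursively defined powers `B_q = β_0 ⋯ β_{q-1}`: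
  `Tr′_q((T(S_0) · [λ_0]) · B_q) = Tr_q(S_q) + Σ_{i<q} V_i(Tr_i(S_i))`, i.e. the TRIANGULAR re-expansion
  `σ′_q(θ x) = σ_q(x) + Σ_{i<q} u_{q,i}(σ_i(x))` that th-4's `isISemiregular_iff_twist` consumes, with the mixing maps
  EXISTENTIAL (they are binomially weighted iterated cups with `[dlog g] ∧ –`; only existence and additivity matter for
  the kernel clause);
* **`exists_triangular_pow`** — the same written with `x ∈ Ext²(E, E)`, `ι : E → F_0`, `ι′ : T E → G_0`
  (`T(ι) ≫ λ_0 = ι′`) and powers `A_q = α_0 ⋯ α_{q-1}`: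
  `Tr′_q((T(x) · [ι′]) · B_q) = Tr_q((x · [ι]) · A_q) + Σ_{i<q} V_i(Tr_i((x · [ι]) · A_i))` — on the tree's carriers
  literally `σ_q^{E⟨c⟩}(θ x) = σ_q^E(x) + Σ_{i<q} u_{q,i}(σ_i^E(x))` before `extToCohomology` (`sigmaHigher_apply`).

## References

* R.-O. Buchweitz, H. Flenner, *A semiregularity map for modules and applications to deformations*, Compositio
  Math. 137 (2003), §4 (the algebra `A`, `At^k`, the trace), Def. 4.1. [BuchweitzFlenner2003]
* M. F. Atiyah, *Complex analytic connections in fibre bundles*, Trans. AMS 85 (1957), Prop. 10, Prop. 12. [Atiyah1957]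
* D. Huybrechts, M. Lehn, *The geometry of moduli spaces of sheaves* (1997), §10.1.5 (Leibniz rule). [HuybrechtsLehn1997]
* S. Mac Lane, *Homology* (1963), III.5–III.6 (Yoneda composition of extensions).
-/

noncomputable section

open CategoryTheory CategoryTheory.Abelian Limits Finset

namespace Summit.Ventures.HSemireg

namespace LeibnizChain

universe t w w' v v' u u'

/-! ### Yoneda chains `β_j · β_{j+1} ⋯ β_{q-1}` with free endpoints -/

section Chain

variable {D : Type u'} [Category.{v'} D] [Abelian D] [HasExt.{w'} D] (G : ℕ → D)
  (β : ∀ j, Ext.{w'} (G j) (G (j + 1)) 1)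

/-- **`c ∈ Extⁿ(G_j, G_q)` is the Yoneda chain `β_j · β_{j+1} ⋯ β_{q-1}`** (Mathlib `Ext.comp` order; the empty
chain at `G_j` is `[𝟙]`, and a chain ending at `G_q` extends to `G_{q+1}` by `· β_q`). Start, end and length are
indices of the predicate, so no transport along `(j + 1) + k = j + (k + 1)` is ever needed. [folklore] -/
inductive IsExtChain : ∀ (j q n : ℕ), Ext.{w'} (G j) (G q) n → Prop
  | nil (j : ℕ) : IsExtChain j j 0 (Ext.mk₀ (𝟙 (G j)))
  | snoc {j q n : ℕ} {c : Ext.{w'} (G j) (G q) n} (h : IsExtChain j q n c) :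
      IsExtChain j (q + 1) (n + 1) (c.comp (β q) rfl)

variable {G β}

/-- The length of a chain is the difference of its endpoints: `j + n = q`. [folklore] -/
theorem IsExtChain.add_eq {j q n : ℕ} {c : Ext.{w'} (G j) (G q) n} (h : IsExtChain G β j q n c) : j + n = q := by
  induction h with
  | nil => rfl
  | snoc _ ih => omega

/-- A chain is determined by its endpoints (and length). [folklore] -/
theorem IsExtChain.unique {j q n : ℕ} {c c' : Ext.{w'} (G j) (G q) n} (h : IsExtChain G β j q n c)
    (h' : IsExtChain G β j q n c') : c = c' := by
  induction h with
  | nil =>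
    cases h'
    rfl
  | snoc h ih =>
    cases h' with
    | snoc h'' => rw [ih h'']

variable (G β) in
/-- The chain `β_j ⋯ β_{j+k-1} ∈ Ext^k(G_j, G_{j+k})` exists. [folklore] -/
theorem exists_isExtChain (j k : ℕ) : ∃ c : Ext.{w'} (G j) (G (j + k)) k, IsExtChain G β j (j + k) k c := by
  induction k with
  | zero => exact ⟨Ext.mk₀ (𝟙 _), IsExtChain.nil j⟩
  | succ k ih =>
    obtain ⟨c, hc⟩ := ih
    exact ⟨c.comp (β (j + k)) rfl, hc.snoc⟩

variable (G β) in
/-- The chain from `G_j` to `G_q` exists whenever `j ≤ q`. [folklore] -/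
theorem exists_isExtChain_of_le {j q : ℕ} (hjq : j ≤ q) :
    ∃ (n : ℕ) (c : Ext.{w'} (G j) (G q) n), IsExtChain G β j q n c := by
  obtain ⟨k, rfl⟩ := Nat.exists_eq_add_of_le hjq
  exact ⟨k, exists_isExtChain G β j k⟩

/-- **Prepending**: a chain `β_j ⋯ β_{q-1}` of length `m = n + 1` is `β_j · (β_{j+1} ⋯ β_{q-1})`. [folklore] -/
theorem IsExtChain.exists_cons {j q m : ℕ} {c : Ext.{w'} (G j) (G q) m} (h : IsExtChain G β j q m c) {n : ℕ}
    (hm : m = n + 1) :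
    ∃ c' : Ext.{w'} (G (j + 1)) (G q) n, IsExtChain G β (j + 1) q n c' ∧ c = (β j).comp c' (by omega) := by
  induction h generalizing n with
  | nil => exact absurd hm.symm (Nat.succ_ne_zero n)
  | @snoc q₁ n₁ c₁ h₁ ih =>
    obtain rfl : n = n₁ := (Nat.succ_injective hm).symm
    cases h₁ with
    | nil =>
      refine ⟨Ext.mk₀ (𝟙 _), IsExtChain.nil (j + 1), ?_⟩
      rw [Ext.mk₀_id_comp, Ext.comp_mk₀_id]
    | @snoc q₂ n₂ c₂ h₂ =>
      obtain ⟨c', hc', e⟩ := ih rfl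
      refine ⟨c'.comp (β (q₂ + 1)) rfl, hc'.snoc, ?_⟩
      rw [e]
      exact Ext.comp_assoc (β j) c' (β (q₂ + 1)) (add_comm 1 n₂) rfl (by omega)

/-- **Pushing a commuting family through a chain**: if `γ_m · β_{m+1} = β_m · γ_{m+1}` for all `m` with `m + 1 < M`,
then for a chain `c = β_j ⋯ β_{q-1}` with `q < M`, `c · γ_q = γ_j · c⁺` where `c⁺ = β_{j+1} ⋯ β_q` — the chain-level
form of Buchweitz–Flenner's centrality of `1 ⊗ c` in the algebra `A`. [folklore] -/
theorem IsExtChain.comp_central {M : ℕ} (γ : ∀ j, Ext.{w'} (G j) (G (j + 1)) 1)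
    (hγ : ∀ m, m + 1 < M → (γ m).comp (β (m + 1)) (rfl : 1 + 1 = 2) = (β m).comp (γ (m + 1)) rfl)
    {j q n : ℕ} {c : Ext.{w'} (G j) (G q) n} (h : IsExtChain G β j q n c) (hq : q < M) :
    ∃ c' : Ext.{w'} (G (j + 1)) (G (q + 1)) n, IsExtChain G β (j + 1) (q + 1) n c' ∧
      c.comp (γ q) (rfl : n + 1 = n + 1) = (γ j).comp c' (add_comm 1 n) := by
  induction h with
  | nil =>
    refine ⟨Ext.mk₀ (𝟙 _), IsExtChain.nil (j + 1), ?_⟩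
    rw [Ext.mk₀_id_comp, Ext.comp_mk₀_id]
  | @snoc q₁ n₁ c₁ h₁ ih =>
    obtain ⟨c', hc', e⟩ := ih (by omega)
    refine ⟨c'.comp (β (q₁ + 1)) rfl, hc'.snoc, ?_⟩
    rw [Ext.comp_assoc c₁ (β q₁) (γ (q₁ + 1)) rfl rfl rfl, ← hγ q₁ hq,
      ← Ext.comp_assoc c₁ (γ q₁) (β (q₁ + 1)) rfl rfl rfl, e]
    exact Ext.comp_assoc (γ j) c' (β (q₁ + 1)) (add_comm 1 n₁) rfl (by omega)

/-- **Recursively defined powers are chains**: if `B_0 = [𝟙]` and `B_{q+1} = B_q · β_q` (e.g. `At(E)^q`), then `B_q`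
is the chain `β_0 ⋯ β_{q-1}`. [folklore] -/
theorem isExtChain_of_pow (B : ∀ q, Ext.{w'} (G 0) (G q) q) (hB0 : B 0 = Ext.mk₀ (𝟙 _))
    (hBs : ∀ q, B (q + 1) = (B q).comp (β q) rfl) (q : ℕ) : IsExtChain G β 0 q q (B q) := by
  induction q with
  | zero => rw [hB0]; exact IsExtChain.nil 0
  | succ q ih => rw [hBs]; exact ih.snoc

end Chain

/-! ### The triangular re-expansion -/

section Triangular

variable {C : Type u} [Category.{v} C] [Abelian C] {D : Type u'} [Category.{v'} D] [Abelian D]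
  [HasExt.{w} C] [HasExt.{w'} D] (T : C ⥤ D) [T.Additive] [PreservesFiniteLimits T] [PreservesFiniteColimits T]
  {E : C} {F : ℕ → C} {G : ℕ → D} (lam : ∀ j, T.obj (F j) ⟶ G j)
  (α : ∀ j, Ext.{w} (F j) (F (j + 1)) 1) (β γ : ∀ j, Ext.{w'} (G j) (G (j + 1)) 1)
  {W : ℕ → Type t} [∀ i, AddCommMonoid (W i)]
  (Tr : ∀ i, Ext.{w} E (F i) (i + 2) →+ W i) (Tr' : ∀ i, Ext.{w'} (T.obj E) (G i) (i + 2) →+ W i)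
  (K : ∀ i, W i →+ W (i + 1)) (N : ℕ)
  (hLeib : ∀ j, j + 1 ≤ N → (Ext.mk₀ (lam j)).comp (β j) (zero_add 1) =
    ((α j).mapExactFunctor T).comp (Ext.mk₀ (lam (j + 1))) (add_zero 1) + (Ext.mk₀ (lam j)).comp (γ j) (zero_add 1))
  (hcen : ∀ m, m + 1 < N → (γ m).comp (β (m + 1)) (rfl : 1 + 1 = 2) = (β m).comp (γ (m + 1)) rfl)
  (hdual : ∀ i, i ≤ N → ∀ y : Ext.{w} E (F i) (i + 2),
    Tr' i ((y.mapExactFunctor T).comp (Ext.mk₀ (lam i)) (add_zero _)) = Tr i y)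
  (hlin : ∀ i, i + 1 ≤ N → ∀ y : Ext.{w'} (T.obj E) (G i) (i + 2), Tr' (i + 1) (y.comp (γ i) rfl) = K i (Tr' i y))

include hLeib hcen hdual hlin in
/-- **The triangular re-expansion along a Yoneda chain.** For `j + k = q ≤ N` there are additive maps
`V_i : W_i → W_q` such that for every family `S_i ∈ Ext^{i+2}(E, F_i)` with `S_{i+1} = S_i · α_i` and every Yoneda chain
`c = β_j ⋯ β_{q-1}`: `Tr′_q((T(S_j) · [λ_j]) · c) = Tr_q(S_q) + Σ_{i<q} V_i(Tr_i(S_i))`. Induction on `k`: prepend `β_j`,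
apply the Leibniz rule `[λ_j] · β_j = T(α_j) · [λ_{j+1}] + [λ_j] · γ_j`, push `γ_j` through `β_{j+1} ⋯ β_{q-1}` by
centrality, and use the linearity of `Tr′` over `γ`. [cite: BuchweitzFlenner2003, §4 and Def. 4.1; Atiyah1957, Prop. 10 and Prop. 12] -/
theorem exists_triangular_chain (k : ℕ) : ∀ (j q : ℕ), j + k = q → q ≤ N →
    ∃ V : ∀ i, W i →+ W q, ∀ (S : ∀ i, Ext.{w} E (F i) (i + 2))
      (_ : ∀ i, i + 1 ≤ N → S (i + 1) = (S i).comp (α i) rfl)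
      (n : ℕ) (c : Ext.{w'} (G j) (G q) n) (_ : IsExtChain G β j q n c) (h : j + 2 + n = q + 2),
      Tr' q ((((S j).mapExactFunctor T).comp (Ext.mk₀ (lam j)) (add_zero _)).comp c h) =
        Tr q (S q) + ∑ i ∈ range q, V i (Tr i (S i)) := by
  induction k with
  | zero =>
    intro j q hjq hqN
    obtain rfl : j = q := by omega
    refine ⟨fun _ => 0, fun S hS n c hc h => ?_⟩
    have hn : n = 0 := by have := hc.add_eq; omega
    subst hn
    cases hc with
    | nil =>
      simp only [AddMonoidHom.zero_apply, sum_const_zero, add_zero, Ext.comp_mk₀_id]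
      exact hdual j hqN (S j)
  | succ k ih =>
    intro j q hjq hqN
    obtain ⟨q₀, rfl⟩ : ∃ q₀, q = q₀ + 1 := ⟨j + k, by omega⟩
    obtain ⟨V₁, hV₁⟩ := ih (j + 1) (q₀ + 1) (by omega) hqN
    obtain ⟨V₀, hV₀⟩ := ih j q₀ (by omega) (by omega)
    refine ⟨fun i => V₁ i + (if i < q₀ then (K q₀).comp (V₀ i) else 0) +
      Pi.single (M := fun i => W i →+ W (q₀ + 1)) q₀ (K q₀) i, fun S hS n c hc h => ?_⟩
    -- the chain is `β_j · c'`, `c' = β_{j+1} ⋯ β_{q₀}`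
    obtain ⟨n', rfl⟩ : ∃ n', n = n' + 1 := ⟨k, by have := hc.add_eq; omega⟩
    obtain ⟨c', hc', rfl⟩ := hc.exists_cons rfl
    -- `γ_j · c' = c₀ · γ_{q₀}` with `c₀ = β_j ⋯ β_{q₀-1}`
    obtain ⟨n₀, c₀, hc₀⟩ := exists_isExtChain_of_le G β (show j ≤ q₀ by omega)
    obtain rfl : n' = n₀ := by have := hc₀.add_eq; have := hc'.add_eq; omega
    obtain ⟨c'', hc'', hcomm⟩ := hc₀.comp_central γ hcen (show q₀ < N by omega)
    obtain rfl : c' = c'' := hc'.unique hc''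
    -- reassociate and apply the Leibniz rule
    have hA : ((((S j).mapExactFunctor T).comp (Ext.mk₀ (lam j)) (add_zero _)).comp ((β j).comp c' (by omega)) h) =
        ((((S j).mapExactFunctor T).comp ((Ext.mk₀ (lam j)).comp (β j) (zero_add 1))
          (show j + 2 + 1 = j + 1 + 2 by omega)).comp c' (show j + 1 + 2 + n' = q₀ + 1 + 2 by omega)) := by
      rw [← Ext.comp_assoc (((S j).mapExactFunctor T).comp (Ext.mk₀ (lam j)) (add_zero _)) (β j) c'
        (show j + 2 + 1 = j + 1 + 2 by omega) (by omega) (by omega), Ext.comp_assoc_of_second_deg_zero]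
    rw [hA, hLeib j (by omega), Ext.comp_add, Ext.add_comp, map_add]
    -- first term: `T(S_j) · T(α_j) · [λ_{j+1}] · c' = T(S_{j+1}) · [λ_{j+1}] · c'`
    have h1 : (((S j).mapExactFunctor T).comp (((α j).mapExactFunctor T).comp (Ext.mk₀ (lam (j + 1))) (add_zero 1))
          (show j + 2 + 1 = j + 1 + 2 by omega)) =
        ((S (j + 1)).mapExactFunctor T).comp (Ext.mk₀ (lam (j + 1))) (add_zero _) := by
      rw [hS j (by omega), Ext.mapExactFunctor_comp, Ext.comp_assoc_of_third_deg_zero]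
    -- second term: `T(S_j) · [λ_j] · γ_j · c' = (T(S_j) · [λ_j] · c₀) · γ_{q₀}`
    have h2 : (((S j).mapExactFunctor T).comp ((Ext.mk₀ (lam j)).comp (γ j) (zero_add 1))
          (show j + 2 + 1 = j + 1 + 2 by omega)).comp c' (show j + 1 + 2 + n' = q₀ + 1 + 2 by omega) =
        (((((S j).mapExactFunctor T).comp (Ext.mk₀ (lam j)) (add_zero _)).comp c₀
          (show j + 2 + n' = q₀ + 2 by omega)).comp (γ q₀) rfl) := by
      rw [← Ext.comp_assoc_of_second_deg_zero,
        Ext.comp_assoc (((S j).mapExactFunctor T).comp (Ext.mk₀ (lam j)) (add_zero _)) (γ j) c'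
          (show j + 2 + 1 = j + 1 + 2 by omega) (add_comm 1 n') (by omega), ← hcomm,
        ← Ext.comp_assoc (((S j).mapExactFunctor T).comp (Ext.mk₀ (lam j)) (add_zero _)) c₀ (γ q₀)
          (show j + 2 + n' = q₀ + 2 by omega) rfl (by omega)]
    rw [h1, h2, hV₁ S hS n' c' hc', hlin q₀ (by omega), hV₀ S hS n' c₀ hc₀]
    -- bookkeeping of the mixing maps
    simp only [AddMonoidHom.add_apply, sum_add_distrib, map_add, map_sum]
    have hite : ∑ i ∈ range (q₀ + 1), (if i < q₀ then (K q₀).comp (V₀ i) else 0) (Tr i (S i)) =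
        ∑ i ∈ range q₀, K q₀ (V₀ i (Tr i (S i))) := by
      rw [sum_range_succ, if_neg (lt_irrefl q₀), AddMonoidHom.zero_apply, add_zero]
      exact sum_congr rfl fun i hi => by rw [if_pos (mem_range.mp hi)]; rfl
    have hsingle : ∑ i ∈ range (q₀ + 1), (Pi.single (M := fun i => W i →+ W (q₀ + 1)) q₀ (K q₀) i) (Tr i (S i)) =
        K q₀ (Tr q₀ (S q₀)) := by
      rw [sum_eq_single_of_mem q₀ (mem_range.mpr (Nat.lt_succ_self q₀))
        (fun i _ hi => by rw [Pi.single_eq_of_ne hi, AddMonoidHom.zero_apply]), Pi.single_eq_same]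
    rw [hite, hsingle]
    abel

include hLeib hcen hdual hlin in
/-- **The triangular Leibniz re-expansion of the traced Yoneda powers** (all rows `q ≤ N` of `hσ`): for recursively
defined powers `B_q = β_0 ⋯ β_{q-1}` (`B_0 = [𝟙]`, `B_{q+1} = B_q · β_q`, e.g. `At(E⟨c⟩)^q`) there are additive maps
`V_i : W_i → W_q` with `Tr′_q((T(S_0) · [λ_0]) · B_q) = Tr_q(S_q) + Σ_{i<q} V_i(Tr_i(S_i))` for every family
`S_{i+1} = S_i · α_i` — read `σ_q^{E⟨c⟩}(θ x) = σ_q^E(x) + Σ_{i<q} u_{q,i}(σ_i^E(x))`, the hypothesis `hσ` of th-4's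
`isISemiregular_iff_twist`, with existential mixing maps. [cite: BuchweitzFlenner2003, Def. 4.1 and §5; Atiyah1957, Prop. 10 and Prop. 12] -/
theorem exists_triangular (B : ∀ q, Ext.{w'} (G 0) (G q) q) (hB0 : B 0 = Ext.mk₀ (𝟙 _))
    (hBs : ∀ q, B (q + 1) = (B q).comp (β q) rfl) (q : ℕ) (hq : q ≤ N) :
    ∃ V : ∀ i, W i →+ W q, ∀ (S : ∀ i, Ext.{w} E (F i) (i + 2))
      (_ : ∀ i, i + 1 ≤ N → S (i + 1) = (S i).comp (α i) rfl),
      Tr' q ((((S 0).mapExactFunctor T).comp (Ext.mk₀ (lam 0)) (add_zero _)).comp (B q)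
          (show 0 + 2 + q = q + 2 by omega)) =
        Tr q (S q) + ∑ i ∈ range q, V i (Tr i (S i)) := by
  obtain ⟨V, hV⟩ := exists_triangular_chain T lam α β γ Tr Tr' K N hLeib hcen hdual hlin q 0 q (by omega) hq
  exact ⟨V, fun S hS => hV S hS q (B q) (isExtChain_of_pow B hB0 hBs q) _⟩


include hLeib hcen hdual hlin in
/-- **The triangular Leibniz re-expansion, semiregularity form.** With `ι : E → F_0`, `ι′ : T E → G_0` such that
`T(ι) ≫ λ_0 = ι′` (`UntwistCocycleTwistIota.toTwistHodgeZero_twist`) and recursively defined powers `A_q = α_0 ⋯ α_{q-1}`,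
`B_q = β_0 ⋯ β_{q-1}`: for every `q ≤ N` there are additive `V_i : W_i → W_q` with, for all `x ∈ Ext²(E, E)`,
`Tr′_q((T(x) · [ι′]) · B_q) = Tr_q((x · [ι]) · A_q) + Σ_{i<q} V_i(Tr_i((x · [ι]) · A_i))` — literally
`σ_q^{E⟨c⟩}(θ x) = σ_q^E(x) + Σ_{i<q} u_{q,i}(σ_i^E(x))` before passing to sheaf cohomology (`sigmaHigher_apply`).
[cite: BuchweitzFlenner2003, Def. 4.1 and §5; Atiyah1957, Prop. 10 and Prop. 12] -/
theorem exists_triangular_pow (ι : E ⟶ F 0) (ι' : T.obj E ⟶ G 0) (hι : T.map ι ≫ lam 0 = ι')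
    (A : ∀ q, Ext.{w} (F 0) (F q) q) (hA0 : A 0 = Ext.mk₀ (𝟙 _)) (hAs : ∀ q, A (q + 1) = (A q).comp (α q) rfl)
    (B : ∀ q, Ext.{w'} (G 0) (G q) q) (hB0 : B 0 = Ext.mk₀ (𝟙 _)) (hBs : ∀ q, B (q + 1) = (B q).comp (β q) rfl)
    (q : ℕ) (hq : q ≤ N) :
    ∃ V : ∀ i, W i →+ W q, ∀ x : Ext.{w} E E 2,
      Tr' q ((((x.mapExactFunctor T).comp (Ext.mk₀ ι') (add_zero 2)).comp (B q) (add_comm 2 q))) =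
        Tr q ((x.comp (Ext.mk₀ ι) (add_zero 2)).comp (A q) (add_comm 2 q)) +
          ∑ i ∈ range q, V i (Tr i ((x.comp (Ext.mk₀ ι) (add_zero 2)).comp (A i) (add_comm 2 i))) := by
  obtain ⟨V, hV⟩ := exists_triangular T lam α β γ Tr Tr' K N hLeib hcen hdual hlin B hB0 hBs q hq
  refine ⟨V, fun x => ?_⟩
  have hS : ∀ i, i + 1 ≤ N → (x.comp (Ext.mk₀ ι) (add_zero 2)).comp (A (i + 1)) (add_comm 2 (i + 1)) =
      ((x.comp (Ext.mk₀ ι) (add_zero 2)).comp (A i) (add_comm 2 i)).comp (α i) rfl := fun i _ => by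
    rw [hAs i]
    exact (Ext.comp_assoc _ _ _ (add_comm 2 i) rfl (by omega)).symm
  have h := hV (fun i => (x.comp (Ext.mk₀ ι) (add_zero 2)).comp (A i) (add_comm 2 i)) hS
  -- the head: `T((x · ι) · A_0) · [λ_0] = T(x) · [ι′]`
  have h0 : (x.comp (Ext.mk₀ ι) (add_zero 2)).comp (A 0) (add_comm 2 0) = x.comp (Ext.mk₀ ι) (add_zero 2) := by
    rw [hA0]
    exact Ext.comp_mk₀_id _
  have e1 : (((x.comp (Ext.mk₀ ι) (add_zero 2)).comp (A 0) (add_comm 2 0)).mapExactFunctor T).comp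
      (Ext.mk₀ (lam 0)) (add_zero _) = ((x.mapExactFunctor T).comp (Ext.mk₀ ι') (add_zero 2) :
        Ext.{w'} (T.obj E) (G 0) 2) := by
    rw [h0, ← hι, ← Ext.mk₀_comp_mk₀, ← Ext.comp_assoc_of_third_deg_zero, ← Ext.mapExactFunctor_mk₀,
      ← Ext.mapExactFunctor_comp]
  rw [e1] at h
  exact h

end Triangular

end LeibnizChain

end Summit.Ventures.HSemireg

end
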